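import Summits.HodgeConjecture.HodgeConjecture.Theorems.R90S6HSideEllipticValue   -- ★ H2 (this seat): `orbitalIntegral_coeff_toVector_eq_mul_sum_ncard_displaced_two`, `orbitalIntegral_satakeGraphPartner_torusGen_pow`; brings ★ H1 §3, ★ A1-H, ★ W8-f
import HarnessLib

/-!
# R90 · S6 — CARD H2-NUMBERS (row E1.3.5.2.6, H side): `O_γ(ξ̂_H φ_m)` IN CLOSED FORM — an explicit polynomial in `q_v` against the first-shell ∕ fixed-point data of `γ`
# (`Theorems/R90S6HSideEllipticValueClosed.lean`)

Cell `hodgecm-mathlib`, crux H413 (`stmt-HodgeConjecture-24833`), route of record `HCCMUnconditional`; programme R90-TF, section S6 (base `R90-C14`), seat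
R90-C14-p03 (g2); card «(a) H2-NUMBERS» (dealer R90-C14-plan (g2), R90 bus 2026-09-05T01:46:47Z).  Helper lane `--supports stmt-HodgeConjecture-24833 --as helper`; THEOREMS ONLY
(no definition, no instance, no notation, no named fact, no `sorry`); imports ★ H2 `R90S6HSideEllipticValue` (brings ★ H1 §3 `xiHCoeff`, ★ A1-H, ★ W8-f) + HarnessLib.

THE MATHEMATICS.  ★ H2: `O_γ(ξ̂_H φ_m) = ν(K₀)·Σ_{k ≤ m} c_{m,k}·S_k`, `S_k = #{x self-dual : d(x, γx) = 2k}`, `c_{m,m} = (−q)^m`, `c_{m,k} = (q²−1)(−q)^k q^{2(m−1−k)}` (`k < m`).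
★ A1-H ∕ ★ W8-f (γ fixing a vertex, finite fixed set, every moved vertex of valency `q + 1` — the `(q_v+1)`-regular tree of `U(1,1)_w`): `S_0 = F₀ := #{x self-dual : γx = x}`,
`S_{2n+1} = q^{2n}·N₀`, `S_{2n+2} = q^{2n+1}·N₁` with the FIRST-SHELL DATA `N_i := #{x : d(x, γx) = 2 ∧ type(x) = i}` (`i = 0` self-dual, `i = 1` `ϖ`-modular), i.e.
`S_k = q^{k−1}·N_{[k even]}` (`k ≥ 1`) — §2.  Substituting (§1, pure arithmetic: for `1 ≤ k ≤ m−1` the exponent `k + 2(m−1−k) + (k−1) = 2m−3` does NOT depend on `k`):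
**`O_γ(ξ̂_H φ_m) ∕ ν(K₀) = (q²−1)·q^{2(m−1)}·F₀ + (q²−1)·q^{2m−3}·Σ_{k=1}^{m−1} (−1)^k N_{[k even]} + (−1)^m·q^{2m−1}·N_{[m even]}`** (`m ≥ 1`; §3 abstract `U(1,1)`, §4 at the
inert place with `q = q_v = Nat.sqrt #𝓀[E_w]`); in particular **`m = 1`: `(q²−1)·F₀ − q·N₀`**, **`m = 2`: `q²(q²−1)·F₀ − q(q²−1)·N₀ + q³·N₁`**,
`m = 3`: `q⁴(q²−1)·F₀ + q³(q²−1)·(N₁ − N₀) − q⁵·N₀`.  Per γ-type the data `(F₀, N₀, N₁)` are read off `Fix(γ)` (E1.3.5.2.6's sheet; not typed here).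
HONEST LABEL: arithmetic ∕ measure bookkeeping over ★ carriers (topological, Haar, `hA`, local finiteness and valency hypotheses are BINDERS as in ★ A1-H); proves no printed
global statement, discharges no citation; count-neutral helper until E1.3.5.2.6 consumes it.
HC_CM is proved only modulo the 7 printed citations (2 remaining named inputs: hLiu418 = stmt-HodgeConjecture-24832, h413 = stmt-HodgeConjecture-24833) until rung 0 closes; REL ≠ ★ ≠ BUILT.

## References
* [Rogawski1990] J. D. Rogawski, *Automorphic Representations of Unitary Groups in Three Variables*, Ann. of Math. Stud. 123 (1990): §4.9 pp. 54–56, §4.11 pp. 59–60.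
* [LabesseLanglands1979] J.-P. Labesse, R. P. Langlands, *L-indistinguishability for SL(2)*, Canad. J. Math. 31 (1979): §§2–3.
* [Serre1980Trees] J.-P. Serre, *Trees* (1980): I.2.3, I.6.4 Prop. 24–25, II.1.1.
* [Macdonald1971] I. G. Macdonald, *Spherical functions on a group of p-adic type*, Ramanujan Inst. Publ. 2 (1971), Ch. V §3.
-/

set_option autoImplicit false
-- the mandated namespace repeats the single-problem summit's segment (`HodgeConjecture.HodgeConjecture`)
set_option linter.dupNamespace false

noncomputable section

open MeasureTheory Measure Topology Set Function
open scoped ENNReal NNReal Pointwise ValuativeRel Matrix MatrixGroups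
open MulAction SimpleGraph Matrix ValuativeRel
open Literature.MeasureTheory.Group Literature.NumberTheory.Automorphic Literature.NumberTheory.Automorphic.heckeAlgebra
open Literature.NumberTheory.Automorphic.HermitianLatticeTree
open Literature.Combinatorics.SimpleGraph

namespace Summit.HodgeConjecture.HodgeConjecture.R90.S6

/-! ## §1 Pure arithmetic: the coefficient table against shell counts of the form `S_0 = F₀`, `S_k = q^{k−1} N_{[k even]}` -/

/-- **THE CLOSED SUM** (pure `ℂ`-arithmetic): if `S 0 = F₀` and `S k = q^{k−1}·(N₁ if k even, N₀ if k odd)` for `k ≥ 1`, then for `m ≥ 1`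
`Σ_{k ≤ m} xiHCoeff q m k · S k = (q²−1) q^{2(m−1)} F₀ + (q²−1) q^{2m−3} Σ_{k=1}^{m−1} (−1)^k N_{[k even]} + (−1)^m q^{2m−1} N_{[m even]}` — for `1 ≤ k ≤ m−1` the
exponent `k + 2(m−1−k) + (k−1) = 2m−3` is independent of `k`. [cite: Macdonald1971, Ch. V §3] [cite: Serre1980Trees, I.6.4 Prop. 24] -/
theorem sum_xiHCoeff_mul_shell_eq (q m : ℕ) (hm : 1 ≤ m) (S : ℕ → ℕ) (F₀ N₀ N₁ : ℕ) (h0 : S 0 = F₀)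
    (hS : ∀ k, 1 ≤ k → S k = q ^ (k - 1) * (if Even k then N₁ else N₀)) :
    ∑ k ∈ Finset.range (m + 1), xiHCoeff q m k * (S k : ℂ) =
      ((q : ℂ) ^ 2 - 1) * (q : ℂ) ^ (2 * (m - 1)) * F₀ +
        ((q : ℂ) ^ 2 - 1) * (q : ℂ) ^ (2 * m - 3) * (∑ k ∈ Finset.Ico 1 m, (-1 : ℂ) ^ k * (if Even k then (N₁ : ℂ) else (N₀ : ℂ))) +
        (-1 : ℂ) ^ m * (q : ℂ) ^ (2 * m - 1) * (if Even m then (N₁ : ℂ) else (N₀ : ℂ)) := by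
  rw [Finset.range_eq_Ico, Finset.sum_Ico_succ_top (Nat.zero_le m), Finset.sum_eq_sum_Ico_succ_bot hm, Nat.zero_add]
  have e0 : xiHCoeff q m 0 * (S 0 : ℂ) = ((q : ℂ) ^ 2 - 1) * (q : ℂ) ^ (2 * (m - 1)) * F₀ := by
    rw [h0, xiHCoeff_of_lt hm, pow_zero, mul_one, Nat.sub_zero]
  have em : xiHCoeff q m m * (S m : ℂ) = (-1 : ℂ) ^ m * (q : ℂ) ^ (2 * m - 1) * (if Even m then (N₁ : ℂ) else (N₀ : ℂ)) := by
    rw [hS m hm, xiHCoeff_self, neg_pow]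
    have e : m + (m - 1) = 2 * m - 1 := by omega
    rw [← e, pow_add]
    push_cast
    split_ifs <;> ring
  have emid : ∀ k ∈ Finset.Ico 1 m, xiHCoeff q m k * (S k : ℂ) =
      ((q : ℂ) ^ 2 - 1) * (q : ℂ) ^ (2 * m - 3) * ((-1 : ℂ) ^ k * (if Even k then (N₁ : ℂ) else (N₀ : ℂ))) := by
    intro k hk
    obtain ⟨hk1, hkm⟩ := Finset.mem_Ico.mp hk
    rw [hS k hk1, xiHCoeff_of_lt hkm, neg_pow]
    have e : k + 2 * (m - 1 - k) + (k - 1) = 2 * m - 3 := by omega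
    rw [← e, pow_add, pow_add]
    push_cast
    split_ifs <;> ring
  rw [e0, em, Finset.sum_congr rfl emid, ← Finset.mul_sum]

/-- **`m = 1`**: `Σ_{k ≤ 1} xiHCoeff q 1 k · S k = (q²−1)·F₀ − q·N₀` (`ξ̂_H(φ₁) = −q φ′₁ + (q²−1)·1`). [cite: Macdonald1971, Ch. V §3] -/
theorem sum_xiHCoeff_mul_shell_one (q : ℕ) (S : ℕ → ℕ) (F₀ N₀ N₁ : ℕ) (h0 : S 0 = F₀)
    (hS : ∀ k, 1 ≤ k → S k = q ^ (k - 1) * (if Even k then N₁ else N₀)) :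
    ∑ k ∈ Finset.range (1 + 1), xiHCoeff q 1 k * (S k : ℂ) = ((q : ℂ) ^ 2 - 1) * F₀ - q * N₀ := by
  rw [sum_xiHCoeff_mul_shell_eq q 1 le_rfl S F₀ N₀ N₁ h0 hS, Finset.Ico_self, Finset.sum_empty, if_neg Nat.not_even_one]
  ring

/-- **`m = 2`**: `Σ_{k ≤ 2} xiHCoeff q 2 k · S k = q²(q²−1)·F₀ − q(q²−1)·N₀ + q³·N₁`. [cite: Macdonald1971, Ch. V §3] -/
theorem sum_xiHCoeff_mul_shell_two (q : ℕ) (S : ℕ → ℕ) (F₀ N₀ N₁ : ℕ) (h0 : S 0 = F₀)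
    (hS : ∀ k, 1 ≤ k → S k = q ^ (k - 1) * (if Even k then N₁ else N₀)) :
    ∑ k ∈ Finset.range (2 + 1), xiHCoeff q 2 k * (S k : ℂ) =
      (q : ℂ) ^ 2 * ((q : ℂ) ^ 2 - 1) * F₀ - q * ((q : ℂ) ^ 2 - 1) * N₀ + (q : ℂ) ^ 3 * N₁ := by
  rw [sum_xiHCoeff_mul_shell_eq q 2 (by norm_num) S F₀ N₀ N₁ h0 hS,
    show Finset.Ico 1 2 = {1} from rfl, Finset.sum_singleton, if_neg Nat.not_even_one, if_pos even_two]
  ring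

/-! ## §2 `U(1,1)`: the self-dual displacement shells against the first-shell data (`S_0 = F₀`, `S_k = q^{k−1} N_{[k even]}`) -/

section Two

variable {K : Type} [Field K] [Valued K (WithZero (Multiplicative ℤ))] [ValuativeRel K]
  [(Valued.v : Valuation K (WithZero (Multiplicative ℤ))).Compatible] {σ : K →+* K} {ϖ : K}
  (hd : HermitianLattice.UnramifiedLocalConjDatum σ ϖ) (γ : unitaryGroupOfForm σ ((StdForm.antidiagonal 2).over K))

include hd in
/-- **`S_0 = F₀`**: the self-dual vertices displaced by `0` are the self-dual FIXED vertices (the tree is connected ★ `isTree_latticeTree`). [cite: Serre1980Trees, II.1.1] -/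
theorem ncard_selfDual_displaced_zero_eq_ncard_fixed_two :
    {x : {M : Submodule 𝒪[K] (Fin 2 → K) // IsSpecialLattice σ ϖ ((StdForm.antidiagonal 2).over K) M} |
        IsSelfDualLattice σ ((StdForm.antidiagonal 2).over K) x.1 ∧
          (latticeTree σ ϖ ((StdForm.antidiagonal 2).over K)).dist x (latticeTreeIso σ ϖ ((StdForm.antidiagonal 2).over K) γ x) = 2 * 0}.ncard =
      {x : {M : Submodule 𝒪[K] (Fin 2 → K) // IsSpecialLattice σ ϖ ((StdForm.antidiagonal 2).over K) M} |
        IsSelfDualLattice σ ((StdForm.antidiagonal 2).over K) x.1 ∧ latticeTreeIso σ ϖ ((StdForm.antidiagonal 2).over K) γ x = x}.ncard := by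
  haveI := isDiscreteValuationRing_integer_of_compatible hd.vϖ
  have hT := isTree_latticeTree σ (valuation_map_eq_of_datum hd) (isUniformizingElement_of_v_eq hd.vϖ) (isUnimodular₂_antidiagonal_two (K := K))
  congr 1
  ext x
  simp only [Set.mem_setOf_eq, Nat.mul_zero, hT.connected.dist_eq_zero_iff]
  exact ⟨fun h => ⟨h.1, h.2.symm⟩, fun h => ⟨h.1, h.2.symm⟩⟩

/-- **`S_k = q^{k−1}·N_{[k even]}` (`k ≥ 1`)** on the rank-one tree: for `γ` fixing a vertex `u` with finite fixed set, the tree locally finite, a type function `c` (`c v = 0 ↔ v`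
self-dual) and every MOVED vertex of valency `q + 1`: `#{x self-dual : d(x, γx) = 2k} = q^{k−1}·#{x : d(x, γx) = 2 ∧ c x = [k even]}` — ★ W8-f
`ncard_displaced_inter_type_eq_of_odd ∕ _of_even` at `q₀ = q₁ = q` through ★ A1-H `setOf_selfDual_displaced_eq_setOf_displaced_type_zero_two`.
[cite: Serre1980Trees, I.2.3, I.6.4 Prop. 24] [cite: LabesseLanglands1979, §§2–3] -/
theorem ncard_selfDual_displaced_eq_pow_mul_firstShell_two (hd : HermitianLattice.UnramifiedLocalConjDatum σ ϖ)
    (hloc : ∀ v, ((latticeTree σ ϖ ((StdForm.antidiagonal 2).over K)).neighborSet v).Finite)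
    {u : {M : Submodule 𝒪[K] (Fin 2 → K) // IsSpecialLattice σ ϖ ((StdForm.antidiagonal 2).over K) M}}
    (hu : latticeTreeIso σ ϖ ((StdForm.antidiagonal 2).over K) γ u = u)
    (hfix : {v | latticeTreeIso σ ϖ ((StdForm.antidiagonal 2).over K) γ v = v}.Finite)
    (c : {M : Submodule 𝒪[K] (Fin 2 → K) // IsSpecialLattice σ ϖ ((StdForm.antidiagonal 2).over K) M} → Fin 2)
    (hc0 : ∀ v, c v = 0 ↔ IsSelfDualLattice σ ((StdForm.antidiagonal 2).over K) v.1) (q : ℕ)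
    (hdeg : ∀ v, latticeTreeIso σ ϖ ((StdForm.antidiagonal 2).over K) γ v ≠ v →
      ((latticeTree σ ϖ ((StdForm.antidiagonal 2).over K)).neighborSet v).ncard = q + 1) (k : ℕ) (hk : 1 ≤ k) :
    {x : {M : Submodule 𝒪[K] (Fin 2 → K) // IsSpecialLattice σ ϖ ((StdForm.antidiagonal 2).over K) M} |
        IsSelfDualLattice σ ((StdForm.antidiagonal 2).over K) x.1 ∧
          (latticeTree σ ϖ ((StdForm.antidiagonal 2).over K)).dist x (latticeTreeIso σ ϖ ((StdForm.antidiagonal 2).over K) γ x) = 2 * k}.ncard =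
      q ^ (k - 1) *
        (if Even k then
          {x : {M : Submodule 𝒪[K] (Fin 2 → K) // IsSpecialLattice σ ϖ ((StdForm.antidiagonal 2).over K) M} |
            (latticeTree σ ϖ ((StdForm.antidiagonal 2).over K)).dist x (latticeTreeIso σ ϖ ((StdForm.antidiagonal 2).over K) γ x) = 2 ∧ c x = 1}.ncard
        else
          {x : {M : Submodule 𝒪[K] (Fin 2 → K) // IsSpecialLattice σ ϖ ((StdForm.antidiagonal 2).over K) M} |
            (latticeTree σ ϖ ((StdForm.antidiagonal 2).over K)).dist x (latticeTreeIso σ ϖ ((StdForm.antidiagonal 2).over K) γ x) = 2 ∧ c x = 0}.ncard) := by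
  classical
  haveI := isDiscreteValuationRing_integer_of_compatible hd.vϖ
  have hT := isTree_latticeTree σ (valuation_map_eq_of_datum hd) (isUniformizingElement_of_v_eq hd.vϖ) (isUnimodular₂_antidiagonal_two (K := K))
  haveI : (latticeTree σ ϖ ((StdForm.antidiagonal 2).over K)).LocallyFinite := fun v => (hloc v).fintype
  have hdeg' : ∀ v, latticeTreeIso σ ϖ ((StdForm.antidiagonal 2).over K) γ v ≠ v →
      (latticeTree σ ϖ ((StdForm.antidiagonal 2).over K)).degree v = (fun _ : Fin 2 => q) (c v) + 1 := fun v hv => by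
    rw [TreeDisplacement.degree_eq_ncard_neighborSet]; exact hdeg v hv
  rw [setOf_selfDual_displaced_eq_setOf_displaced_type_zero_two γ c hc0]
  rcases Nat.even_or_odd' k with ⟨n, hn | hn⟩
  · -- `k = 2n`, `n = n' + 1`, `k = 2n' + 2`
    obtain ⟨n', rfl⟩ := Nat.exists_eq_succ_of_ne_zero (show n ≠ 0 by omega)
    have hke : Even k := ⟨n' + 1, by omega⟩
    have hk2 : k = 2 * n' + 2 := by omega
    rw [if_pos hke, hk2, ncard_displaced_inter_type_eq_of_even hT (latticeTreeIso σ ϖ ((StdForm.antidiagonal 2).over K) γ) hu hfix c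
      (typeFun_ne_of_adj_two hd c hc0) (fun _ : Fin 2 => q) hdeg' Fin.zero_ne_one n', show 2 * n' + 2 - 1 = 2 * n' + 1 by omega, pow_succ,
      ← pow_two, ← pow_mul]
    ring
  · -- `k = 2n + 1`
    have hko : ¬ Even k := by rw [hn, Nat.even_add_one]; exact not_not.mpr (even_two_mul n)
    rw [if_neg hko, hn, ncard_displaced_inter_type_eq_of_odd hT (latticeTreeIso σ ϖ ((StdForm.antidiagonal 2).over K) γ) hu hfix c
      (typeFun_ne_of_adj_two hd c hc0) (fun _ : Fin 2 => q) hdeg' Fin.zero_ne_one n, Nat.add_sub_cancel, ← pow_two, ← pow_mul]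

/-! ## §3 `U(1,1)`: the orbital integral of the function of `Σ_{k ≤ m} xiHCoeff q m k • φ′_k` in closed form -/

variable (t : unitaryGroupOfForm σ ((StdForm.antidiagonal 2).over K))
  (ht : (t : GL (Fin 2) K) = zpowDiagGL (CartanUnique.uniformizer_ne_zero hd.vϖ) ![(1 : ℤ), -1])
  (hA : ∀ M : Submodule 𝒪[K] (Fin 2 → K), IsSelfDualLattice σ ((StdForm.antidiagonal 2).over K) M →
    ∃ u : unitaryGroupOfForm σ ((StdForm.antidiagonal 2).over K), latt (((u : GL (Fin 2) K)) : Matrix (Fin 2) (Fin 2) K) = M)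
  [IsHeckeTriple (⊤ : Submonoid (unitaryGroupOfForm σ ((StdForm.antidiagonal 2).over K)))
    (HermitianLattice.unitaryInt σ ((StdForm.antidiagonal 2).over K)) (HermitianLattice.unitaryInt σ ((StdForm.antidiagonal 2).over K))]
  [LocallyCompactSpace (unitaryGroupOfForm σ ((StdForm.antidiagonal 2).over K))]
  [SecondCountableTopology (unitaryGroupOfForm σ ((StdForm.antidiagonal 2).over K))]
  [MeasurableSpace (unitaryGroupOfForm σ ((StdForm.antidiagonal 2).over K))] [BorelSpace (unitaryGroupOfForm σ ((StdForm.antidiagonal 2).over K))]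
  [MeasurableSpace (unitaryGroupOfForm σ ((StdForm.antidiagonal 2).over K) ⧸
    Subgroup.centralizer ({γ} : Set (unitaryGroupOfForm σ ((StdForm.antidiagonal 2).over K))))]
  [BorelSpace (unitaryGroupOfForm σ ((StdForm.antidiagonal 2).over K) ⧸
    Subgroup.centralizer ({γ} : Set (unitaryGroupOfForm σ ((StdForm.antidiagonal 2).over K))))]
  [hC : IsClosed ((Subgroup.centralizer ({γ} : Set (unitaryGroupOfForm σ ((StdForm.antidiagonal 2).over K))) :
    Subgroup (unitaryGroupOfForm σ ((StdForm.antidiagonal 2).over K))) : Set (unitaryGroupOfForm σ ((StdForm.antidiagonal 2).over K)))]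
  (ρ : Measure (Subgroup.centralizer ({γ} : Set (unitaryGroupOfForm σ ((StdForm.antidiagonal 2).over K)))))
  [ρ.IsMulLeftInvariant] [IsFiniteMeasureOnCompacts ρ] [ρ.IsOpenPosMeasure] [ρ.IsInvInvariant] [SFinite ρ]
  (ν : Measure (unitaryGroupOfForm σ ((StdForm.antidiagonal 2).over K))) [IsHaarMeasure ν] [ν.IsMulRightInvariant]
  [CompactSpace (Subgroup.centralizer ({γ} : Set (unitaryGroupOfForm σ ((StdForm.antidiagonal 2).over K))))]
  (hρ : ρ Set.univ = 1)
include ht hA hρ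

/-- **`U(1,1)` — `O_γ(fun of Σ_{k ≤ m} c_{m,k} φ′_k)` IN CLOSED FORM** (`γ` with COMPACT centraliser of mass-one `ρ` fixing a vertex `u`, finite fixed set, locally finite tree, type
function `c`, every moved vertex of valency `q + 1`, `ν` Haar with `ν(K₀) < ∞`, `m ≥ 1`, `T = Σ_{k ≤ m} xiHCoeff q m k • φ′_k`):
`O_γ^{ν∕ρ}(g ↦ (T [K₀])(gK₀)) = ν(K₀)·((q²−1) q^{2(m−1)} F₀ + (q²−1) q^{2m−3} Σ_{k=1}^{m−1} (−1)^k N_{[k even]} + (−1)^m q^{2m−1} N_{[m even]})`, `F₀ = #{x self-dual : γx = x}`,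
`N_i = #{x : d(x, γx) = 2 ∧ c x = i}` — ★ H2 `orbitalIntegral_coeff_toVector_eq_mul_sum_ncard_displaced_two` + §2 + §1.
[cite: Rogawski1990, §4.9 pp. 54–55] [cite: LabesseLanglands1979, §§2–3] [cite: Serre1980Trees, I.6.4 Prop. 24] -/
theorem orbitalIntegral_coeff_toVector_xiHCoeff_eq_closed_two (hνK : ν (HermitianLattice.unitaryInt σ ((StdForm.antidiagonal 2).over K)) ≠ ∞)
    (hloc : ∀ v, ((latticeTree σ ϖ ((StdForm.antidiagonal 2).over K)).neighborSet v).Finite)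
    {u : {M : Submodule 𝒪[K] (Fin 2 → K) // IsSpecialLattice σ ϖ ((StdForm.antidiagonal 2).over K) M}}
    (hu : latticeTreeIso σ ϖ ((StdForm.antidiagonal 2).over K) γ u = u)
    (hfix : {v | latticeTreeIso σ ϖ ((StdForm.antidiagonal 2).over K) γ v = v}.Finite)
    (c : {M : Submodule 𝒪[K] (Fin 2 → K) // IsSpecialLattice σ ϖ ((StdForm.antidiagonal 2).over K) M} → Fin 2)
    (hc0 : ∀ v, c v = 0 ↔ IsSelfDualLattice σ ((StdForm.antidiagonal 2).over K) v.1) (q : ℕ)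
    (hdeg : ∀ v, latticeTreeIso σ ϖ ((StdForm.antidiagonal 2).over K) γ v ≠ v →
      ((latticeTree σ ϖ ((StdForm.antidiagonal 2).over K)).neighborSet v).ncard = q + 1)
    (m : ℕ) (hm : 1 ≤ m)
    (T : heckeAlgebra ℂ (unitaryGroupOfForm σ ((StdForm.antidiagonal 2).over K)) (HermitianLattice.unitaryInt σ ((StdForm.antidiagonal 2).over K)))
    (hT : T = ∑ k ∈ Finset.range (m + 1), xiHCoeff q m k •
      doubleCosetOperator (HermitianLattice.unitaryInt σ ((StdForm.antidiagonal 2).over K)) (t ^ k)) :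
    orbitalIntegral γ (fun x : unitaryGroupOfForm σ ((StdForm.antidiagonal 2).over K) =>
        (toVector (HermitianLattice.unitaryInt σ ((StdForm.antidiagonal 2).over K)) T).coeff
          (x : unitaryGroupOfForm σ ((StdForm.antidiagonal 2).over K) ⧸ HermitianLattice.unitaryInt σ ((StdForm.antidiagonal 2).over K)))
        (quotientMeasure (Subgroup.centralizer ({γ} : Set (unitaryGroupOfForm σ ((StdForm.antidiagonal 2).over K)))) ρ hC ν) =
      (ν (HermitianLattice.unitaryInt σ ((StdForm.antidiagonal 2).over K))).toReal *
        (((q : ℂ) ^ 2 - 1) * (q : ℂ) ^ (2 * (m - 1)) *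
            ({x : {M : Submodule 𝒪[K] (Fin 2 → K) // IsSpecialLattice σ ϖ ((StdForm.antidiagonal 2).over K) M} |
                IsSelfDualLattice σ ((StdForm.antidiagonal 2).over K) x.1 ∧ latticeTreeIso σ ϖ ((StdForm.antidiagonal 2).over K) γ x = x}.ncard : ℕ) +
          ((q : ℂ) ^ 2 - 1) * (q : ℂ) ^ (2 * m - 3) *
            (∑ k ∈ Finset.Ico 1 m, (-1 : ℂ) ^ k *
              (if Even k then
                (({x : {M : Submodule 𝒪[K] (Fin 2 → K) // IsSpecialLattice σ ϖ ((StdForm.antidiagonal 2).over K) M} |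
                    (latticeTree σ ϖ ((StdForm.antidiagonal 2).over K)).dist x (latticeTreeIso σ ϖ ((StdForm.antidiagonal 2).over K) γ x) = 2 ∧
                      c x = 1}.ncard : ℕ) : ℂ)
              else
                (({x : {M : Submodule 𝒪[K] (Fin 2 → K) // IsSpecialLattice σ ϖ ((StdForm.antidiagonal 2).over K) M} |
                    (latticeTree σ ϖ ((StdForm.antidiagonal 2).over K)).dist x (latticeTreeIso σ ϖ ((StdForm.antidiagonal 2).over K) γ x) = 2 ∧
                      c x = 0}.ncard : ℕ) : ℂ))) +
          (-1 : ℂ) ^ m * (q : ℂ) ^ (2 * m - 1) *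
            (if Even m then
              (({x : {M : Submodule 𝒪[K] (Fin 2 → K) // IsSpecialLattice σ ϖ ((StdForm.antidiagonal 2).over K) M} |
                  (latticeTree σ ϖ ((StdForm.antidiagonal 2).over K)).dist x (latticeTreeIso σ ϖ ((StdForm.antidiagonal 2).over K) γ x) = 2 ∧
                    c x = 1}.ncard : ℕ) : ℂ)
            else
              (({x : {M : Submodule 𝒪[K] (Fin 2 → K) // IsSpecialLattice σ ϖ ((StdForm.antidiagonal 2).over K) M} |
                  (latticeTree σ ϖ ((StdForm.antidiagonal 2).over K)).dist x (latticeTreeIso σ ϖ ((StdForm.antidiagonal 2).over K) γ x) = 2 ∧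
                    c x = 0}.ncard : ℕ) : ℂ))) := by
  haveI := isDiscreteValuationRing_integer_of_compatible hd.vϖ
  have hT3 := isTree_latticeTree σ (valuation_map_eq_of_datum hd) (isUniformizingElement_of_v_eq hd.vϖ) (isUnimodular₂_antidiagonal_two (K := K))
  rw [orbitalIntegral_coeff_toVector_eq_mul_sum_ncard_displaced_two hd t ht hA γ ρ ν hρ hνK m (xiHCoeff q m) T hT
      (fun k _ => finite_selfDual_displaced_of_finite_fixedPoints_two hT3 γ hloc hu hfix k)]
  congr 1
  exact sum_xiHCoeff_mul_shell_eq q m hm _ _ _ _ (ncard_selfDual_displaced_zero_eq_ncard_fixed_two hd γ)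
    (fun k hk => ncard_selfDual_displaced_eq_pow_mul_firstShell_two γ hd hloc hu hfix c hc0 q hdeg k hk)

/-- **`U(1,1)`, `m = 1`**: `O_γ^{ν∕ρ}(g ↦ (T [K₀])(gK₀)) = ν(K₀)·((q²−1)·F₀ − q·N₀)` for `T = Σ_{k ≤ 1} xiHCoeff q 1 k • φ′_k = (q²−1)·1 − q φ′₁` (the image `ξ̂_H(φ₁)`).
[cite: Rogawski1990, §4.9 pp. 54–55] [cite: LabesseLanglands1979, §§2–3] -/
theorem orbitalIntegral_coeff_toVector_xiHCoeff_one_eq_two (hνK : ν (HermitianLattice.unitaryInt σ ((StdForm.antidiagonal 2).over K)) ≠ ∞)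
    (hloc : ∀ v, ((latticeTree σ ϖ ((StdForm.antidiagonal 2).over K)).neighborSet v).Finite)
    {u : {M : Submodule 𝒪[K] (Fin 2 → K) // IsSpecialLattice σ ϖ ((StdForm.antidiagonal 2).over K) M}}
    (hu : latticeTreeIso σ ϖ ((StdForm.antidiagonal 2).over K) γ u = u)
    (hfix : {v | latticeTreeIso σ ϖ ((StdForm.antidiagonal 2).over K) γ v = v}.Finite)
    (c : {M : Submodule 𝒪[K] (Fin 2 → K) // IsSpecialLattice σ ϖ ((StdForm.antidiagonal 2).over K) M} → Fin 2)
    (hc0 : ∀ v, c v = 0 ↔ IsSelfDualLattice σ ((StdForm.antidiagonal 2).over K) v.1) (q : ℕ)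
    (hdeg : ∀ v, latticeTreeIso σ ϖ ((StdForm.antidiagonal 2).over K) γ v ≠ v →
      ((latticeTree σ ϖ ((StdForm.antidiagonal 2).over K)).neighborSet v).ncard = q + 1)
    (T : heckeAlgebra ℂ (unitaryGroupOfForm σ ((StdForm.antidiagonal 2).over K)) (HermitianLattice.unitaryInt σ ((StdForm.antidiagonal 2).over K)))
    (hT : T = ∑ k ∈ Finset.range (1 + 1), xiHCoeff q 1 k •
      doubleCosetOperator (HermitianLattice.unitaryInt σ ((StdForm.antidiagonal 2).over K)) (t ^ k)) :
    orbitalIntegral γ (fun x : unitaryGroupOfForm σ ((StdForm.antidiagonal 2).over K) =>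
        (toVector (HermitianLattice.unitaryInt σ ((StdForm.antidiagonal 2).over K)) T).coeff
          (x : unitaryGroupOfForm σ ((StdForm.antidiagonal 2).over K) ⧸ HermitianLattice.unitaryInt σ ((StdForm.antidiagonal 2).over K)))
        (quotientMeasure (Subgroup.centralizer ({γ} : Set (unitaryGroupOfForm σ ((StdForm.antidiagonal 2).over K)))) ρ hC ν) =
      (ν (HermitianLattice.unitaryInt σ ((StdForm.antidiagonal 2).over K))).toReal *
        (((q : ℂ) ^ 2 - 1) *
            ({x : {M : Submodule 𝒪[K] (Fin 2 → K) // IsSpecialLattice σ ϖ ((StdForm.antidiagonal 2).over K) M} |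
                IsSelfDualLattice σ ((StdForm.antidiagonal 2).over K) x.1 ∧ latticeTreeIso σ ϖ ((StdForm.antidiagonal 2).over K) γ x = x}.ncard : ℕ) -
          q * ({x : {M : Submodule 𝒪[K] (Fin 2 → K) // IsSpecialLattice σ ϖ ((StdForm.antidiagonal 2).over K) M} |
                (latticeTree σ ϖ ((StdForm.antidiagonal 2).over K)).dist x (latticeTreeIso σ ϖ ((StdForm.antidiagonal 2).over K) γ x) = 2 ∧
                  c x = 0}.ncard : ℕ)) := by
  haveI := isDiscreteValuationRing_integer_of_compatible hd.vϖ
  have hT3 := isTree_latticeTree σ (valuation_map_eq_of_datum hd) (isUniformizingElement_of_v_eq hd.vϖ) (isUnimodular₂_antidiagonal_two (K := K))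
  rw [orbitalIntegral_coeff_toVector_eq_mul_sum_ncard_displaced_two hd t ht hA γ ρ ν hρ hνK 1 (xiHCoeff q 1) T hT
      (fun k _ => finite_selfDual_displaced_of_finite_fixedPoints_two hT3 γ hloc hu hfix k)]
  congr 1
  exact sum_xiHCoeff_mul_shell_one q _ _ _ _ (ncard_selfDual_displaced_zero_eq_ncard_fixed_two hd γ)
    (fun k hk => ncard_selfDual_displaced_eq_pow_mul_firstShell_two γ hd hloc hu hfix c hc0 q hdeg k hk)

end Two

/-! ## §4 The inert-place edition: `O_γ(ξ̂_H φ_m)` in closed form -/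

section Adic

open NumberField IsDedekindDomain Literature.NumberTheory.Automorphic.UnitaryGroup
  Literature.NumberTheory.Automorphic.HermitianLattice Literature.NumberTheory.Automorphic.CartanUnique

variable {F E : Type} [Field F] [NumberField F] [Field E] [NumberField E] [Algebra F E] [Algebra.IsQuadraticExtension F E]
  (c : E ≃ₐ[F] E) (hc1 : c ≠ 1) (v : HeightOneSpectrum (𝓞 F)) (w : PlacesOver E v) (hw : c • w.1 = w.1)
  (hv : Algebra.IsUnramifiedIn (𝓞 E) v.asIdeal)
  (hA : ∀ M : Submodule 𝒪[w.1.adicCompletion E] (Fin 2 → w.1.adicCompletion E),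
    IsSelfDualLattice (galAdicCompletionMap (L := E) c hw) ((StdForm.antidiagonal 2).over (w.1.adicCompletion E)) M →
      ∃ u : unitaryGroupOfForm (galAdicCompletionMap (L := E) c hw) ((StdForm.antidiagonal 2).over (w.1.adicCompletion E)),
        latt (((u : GL (Fin 2) (w.1.adicCompletion E))) : Matrix (Fin 2) (Fin 2) (w.1.adicCompletion E)) = M)
  [LocallyCompactSpace (unitaryGroupOfForm (galAdicCompletionMap (L := E) c hw) ((StdForm.antidiagonal 2).over (w.1.adicCompletion E)))]
  [SecondCountableTopology (unitaryGroupOfForm (galAdicCompletionMap (L := E) c hw) ((StdForm.antidiagonal 2).over (w.1.adicCompletion E)))]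
  [MeasurableSpace (unitaryGroupOfForm (galAdicCompletionMap (L := E) c hw) ((StdForm.antidiagonal 2).over (w.1.adicCompletion E)))]
  [BorelSpace (unitaryGroupOfForm (galAdicCompletionMap (L := E) c hw) ((StdForm.antidiagonal 2).over (w.1.adicCompletion E)))]
  (γ : unitaryGroupOfForm (galAdicCompletionMap (L := E) c hw) ((StdForm.antidiagonal 2).over (w.1.adicCompletion E)))
  [MeasurableSpace (unitaryGroupOfForm (galAdicCompletionMap (L := E) c hw) ((StdForm.antidiagonal 2).over (w.1.adicCompletion E)) ⧸
    Subgroup.centralizer ({γ} : Set (unitaryGroupOfForm (galAdicCompletionMap (L := E) c hw) ((StdForm.antidiagonal 2).over (w.1.adicCompletion E)))))]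
  [BorelSpace (unitaryGroupOfForm (galAdicCompletionMap (L := E) c hw) ((StdForm.antidiagonal 2).over (w.1.adicCompletion E)) ⧸
    Subgroup.centralizer ({γ} : Set (unitaryGroupOfForm (galAdicCompletionMap (L := E) c hw) ((StdForm.antidiagonal 2).over (w.1.adicCompletion E)))))]
  [hC : IsClosed ((Subgroup.centralizer ({γ} : Set (unitaryGroupOfForm (galAdicCompletionMap (L := E) c hw) ((StdForm.antidiagonal 2).over (w.1.adicCompletion E)))) :
    Subgroup (unitaryGroupOfForm (galAdicCompletionMap (L := E) c hw) ((StdForm.antidiagonal 2).over (w.1.adicCompletion E)))) :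
      Set (unitaryGroupOfForm (galAdicCompletionMap (L := E) c hw) ((StdForm.antidiagonal 2).over (w.1.adicCompletion E))))]
  (ρ : Measure (Subgroup.centralizer ({γ} : Set (unitaryGroupOfForm (galAdicCompletionMap (L := E) c hw) ((StdForm.antidiagonal 2).over (w.1.adicCompletion E))))))
  [ρ.IsMulLeftInvariant] [IsFiniteMeasureOnCompacts ρ] [ρ.IsOpenPosMeasure] [ρ.IsInvInvariant] [SFinite ρ]
  (ν : Measure (unitaryGroupOfForm (galAdicCompletionMap (L := E) c hw) ((StdForm.antidiagonal 2).over (w.1.adicCompletion E))))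
  [IsHaarMeasure ν] [ν.IsMulRightInvariant]
  [CompactSpace (Subgroup.centralizer ({γ} : Set (unitaryGroupOfForm (galAdicCompletionMap (L := E) c hw) ((StdForm.antidiagonal 2).over (w.1.adicCompletion E)))))]
  (hρ : ρ Set.univ = 1)
include hA hρ

/-- **CARD H2-NUMBERS — `O_γ(ξ̂_H φ_m)` IN CLOSED FORM at an inert unramified place `w ∣ v`** (`m ≥ 1`; `γ ∈ U(J₀,2)(E_w)` with COMPACT centraliser of mass-one `ρ` fixing a
vertex `u` of `X₂(E_w)`, finite fixed set; the tree locally finite with every moved vertex of valency `q_v + 1`, `q_v = Nat.sqrt #𝓀[E_w]`; type function `cty`):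
`O_γ^{ν∕ρ}(g ↦ (ξ̂_H(φ_m) [K₀])(gK₀)) = ν(K₀)·((q_v²−1) q_v^{2(m−1)} F₀ + (q_v²−1) q_v^{2m−3} Σ_{k=1}^{m−1} (−1)^k N_{[k even]} + (−1)^m q_v^{2m−1} N_{[m even]})` — §3 fed with ★ H1 §3
`satakeGraphPartnerAlgHom_doubleCosetOperator_torusGen_pow` (`K₀` compact ★ `isCompact_unitaryInt_adicCompletion`).  `m = 1`: `ν(K₀)((q_v²−1)F₀ − q_v N₀)`; `m = 2`:
`ν(K₀)(q_v²(q_v²−1)F₀ − q_v(q_v²−1)N₀ + q_v³N₁)` (§1 `sum_xiHCoeff_mul_shell_one∕two`). [cite: Rogawski1990, §4.9 Prop. 4.9.1 (b), pp. 54–56] [cite: LabesseLanglands1979, §§2–3] -/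
theorem orbitalIntegral_satakeGraphPartner_torusGen_pow_eq_closed
    (hloc : ∀ x, ((latticeTree (galAdicCompletionMap (L := E) c hw) (localConjUniformizer c hc1 v w hw hv)
      ((StdForm.antidiagonal 2).over (w.1.adicCompletion E))).neighborSet x).Finite)
    {u : {M : Submodule 𝒪[w.1.adicCompletion E] (Fin 2 → w.1.adicCompletion E) //
      IsSpecialLattice (galAdicCompletionMap (L := E) c hw) (localConjUniformizer c hc1 v w hw hv) ((StdForm.antidiagonal 2).over (w.1.adicCompletion E)) M}}
    (hu : latticeTreeIso (galAdicCompletionMap (L := E) c hw) (localConjUniformizer c hc1 v w hw hv) ((StdForm.antidiagonal 2).over (w.1.adicCompletion E)) γ u = u)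
    (hfix : {x | latticeTreeIso (galAdicCompletionMap (L := E) c hw) (localConjUniformizer c hc1 v w hw hv)
      ((StdForm.antidiagonal 2).over (w.1.adicCompletion E)) γ x = x}.Finite)
    (cty : {M : Submodule 𝒪[w.1.adicCompletion E] (Fin 2 → w.1.adicCompletion E) //
      IsSpecialLattice (galAdicCompletionMap (L := E) c hw) (localConjUniformizer c hc1 v w hw hv) ((StdForm.antidiagonal 2).over (w.1.adicCompletion E)) M} → Fin 2)
    (hc0 : ∀ x, cty x = 0 ↔ IsSelfDualLattice (galAdicCompletionMap (L := E) c hw) ((StdForm.antidiagonal 2).over (w.1.adicCompletion E)) x.1)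
    (hdeg : ∀ x, latticeTreeIso (galAdicCompletionMap (L := E) c hw) (localConjUniformizer c hc1 v w hw hv)
        ((StdForm.antidiagonal 2).over (w.1.adicCompletion E)) γ x ≠ x →
      ((latticeTree (galAdicCompletionMap (L := E) c hw) (localConjUniformizer c hc1 v w hw hv)
        ((StdForm.antidiagonal 2).over (w.1.adicCompletion E))).neighborSet x).ncard = Nat.sqrt (Nat.card (Valued.ResidueField (w.1.adicCompletion E))) + 1)
    (m : ℕ) (hm : 1 ≤ m) :
    haveI := isHeckeTriple_unitaryInt_adicCompletion c v w hw ((StdForm.antidiagonal 3).over (w.1.adicCompletion E))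
    haveI := isHeckeTriple_unitaryInt_adicCompletion c v w hw ((StdForm.antidiagonal 2).over (w.1.adicCompletion E))
    orbitalIntegral γ
        (fun x : unitaryGroupOfForm (galAdicCompletionMap (L := E) c hw) ((StdForm.antidiagonal 2).over (w.1.adicCompletion E)) =>
          (toVector (unitaryInt (galAdicCompletionMap (L := E) c hw) ((StdForm.antidiagonal 2).over (w.1.adicCompletion E)))
            (satakeGraphPartnerAlgHom c hc1 v w hw hv
              (doubleCosetOperator (unitaryInt (galAdicCompletionMap (L := E) c hw) ((StdForm.antidiagonal 3).over (w.1.adicCompletion E)))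
                ((unramifiedLocalConjDatum_localConjUniformizer c hc1 v w hw hv).torusGen ^ m)))).coeff
            (x : unitaryGroupOfForm (galAdicCompletionMap (L := E) c hw) ((StdForm.antidiagonal 2).over (w.1.adicCompletion E)) ⧸
              unitaryInt (galAdicCompletionMap (L := E) c hw) ((StdForm.antidiagonal 2).over (w.1.adicCompletion E))))
        (quotientMeasure (Subgroup.centralizer ({γ} : Set (unitaryGroupOfForm (galAdicCompletionMap (L := E) c hw)
          ((StdForm.antidiagonal 2).over (w.1.adicCompletion E))))) ρ hC ν) =
      (ν (unitaryInt (galAdicCompletionMap (L := E) c hw) ((StdForm.antidiagonal 2).over (w.1.adicCompletion E)))).toReal *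
        ((((Nat.sqrt (Nat.card (Valued.ResidueField (w.1.adicCompletion E))) : ℕ) : ℂ) ^ 2 - 1) *
            ((Nat.sqrt (Nat.card (Valued.ResidueField (w.1.adicCompletion E))) : ℕ) : ℂ) ^ (2 * (m - 1)) *
            ({x : {M : Submodule 𝒪[w.1.adicCompletion E] (Fin 2 → w.1.adicCompletion E) //
                IsSpecialLattice (galAdicCompletionMap (L := E) c hw) (localConjUniformizer c hc1 v w hw hv) ((StdForm.antidiagonal 2).over (w.1.adicCompletion E)) M} |
                IsSelfDualLattice (galAdicCompletionMap (L := E) c hw) ((StdForm.antidiagonal 2).over (w.1.adicCompletion E)) x.1 ∧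
                  latticeTreeIso (galAdicCompletionMap (L := E) c hw) (localConjUniformizer c hc1 v w hw hv)
                    ((StdForm.antidiagonal 2).over (w.1.adicCompletion E)) γ x = x}.ncard : ℕ) +
          (((Nat.sqrt (Nat.card (Valued.ResidueField (w.1.adicCompletion E))) : ℕ) : ℂ) ^ 2 - 1) *
            ((Nat.sqrt (Nat.card (Valued.ResidueField (w.1.adicCompletion E))) : ℕ) : ℂ) ^ (2 * m - 3) *
            (∑ k ∈ Finset.Ico 1 m, (-1 : ℂ) ^ k *
              (if Even k then
                (({x : {M : Submodule 𝒪[w.1.adicCompletion E] (Fin 2 → w.1.adicCompletion E) //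
                    IsSpecialLattice (galAdicCompletionMap (L := E) c hw) (localConjUniformizer c hc1 v w hw hv) ((StdForm.antidiagonal 2).over (w.1.adicCompletion E)) M} |
                    (latticeTree (galAdicCompletionMap (L := E) c hw) (localConjUniformizer c hc1 v w hw hv)
                        ((StdForm.antidiagonal 2).over (w.1.adicCompletion E))).dist x
                      (latticeTreeIso (galAdicCompletionMap (L := E) c hw) (localConjUniformizer c hc1 v w hw hv)
                        ((StdForm.antidiagonal 2).over (w.1.adicCompletion E)) γ x) = 2 ∧ cty x = 1}.ncard : ℕ) : ℂ)
              else
                (({x : {M : Submodule 𝒪[w.1.adicCompletion E] (Fin 2 → w.1.adicCompletion E) //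
                    IsSpecialLattice (galAdicCompletionMap (L := E) c hw) (localConjUniformizer c hc1 v w hw hv) ((StdForm.antidiagonal 2).over (w.1.adicCompletion E)) M} |
                    (latticeTree (galAdicCompletionMap (L := E) c hw) (localConjUniformizer c hc1 v w hw hv)
                        ((StdForm.antidiagonal 2).over (w.1.adicCompletion E))).dist x
                      (latticeTreeIso (galAdicCompletionMap (L := E) c hw) (localConjUniformizer c hc1 v w hw hv)
                        ((StdForm.antidiagonal 2).over (w.1.adicCompletion E)) γ x) = 2 ∧ cty x = 0}.ncard : ℕ) : ℂ))) +
          (-1 : ℂ) ^ m * ((Nat.sqrt (Nat.card (Valued.ResidueField (w.1.adicCompletion E))) : ℕ) : ℂ) ^ (2 * m - 1) *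
            (if Even m then
              (({x : {M : Submodule 𝒪[w.1.adicCompletion E] (Fin 2 → w.1.adicCompletion E) //
                  IsSpecialLattice (galAdicCompletionMap (L := E) c hw) (localConjUniformizer c hc1 v w hw hv) ((StdForm.antidiagonal 2).over (w.1.adicCompletion E)) M} |
                  (latticeTree (galAdicCompletionMap (L := E) c hw) (localConjUniformizer c hc1 v w hw hv)
                      ((StdForm.antidiagonal 2).over (w.1.adicCompletion E))).dist x
                    (latticeTreeIso (galAdicCompletionMap (L := E) c hw) (localConjUniformizer c hc1 v w hw hv)
                      ((StdForm.antidiagonal 2).over (w.1.adicCompletion E)) γ x) = 2 ∧ cty x = 1}.ncard : ℕ) : ℂ)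
            else
              (({x : {M : Submodule 𝒪[w.1.adicCompletion E] (Fin 2 → w.1.adicCompletion E) //
                  IsSpecialLattice (galAdicCompletionMap (L := E) c hw) (localConjUniformizer c hc1 v w hw hv) ((StdForm.antidiagonal 2).over (w.1.adicCompletion E)) M} |
                  (latticeTree (galAdicCompletionMap (L := E) c hw) (localConjUniformizer c hc1 v w hw hv)
                      ((StdForm.antidiagonal 2).over (w.1.adicCompletion E))).dist x
                    (latticeTreeIso (galAdicCompletionMap (L := E) c hw) (localConjUniformizer c hc1 v w hw hv)
                      ((StdForm.antidiagonal 2).over (w.1.adicCompletion E)) γ x) = 2 ∧ cty x = 0}.ncard : ℕ) : ℂ))) := by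
  haveI := isHeckeTriple_unitaryInt_adicCompletion c v w hw ((StdForm.antidiagonal 3).over (w.1.adicCompletion E))
  haveI := isHeckeTriple_unitaryInt_adicCompletion c v w hw ((StdForm.antidiagonal 2).over (w.1.adicCompletion E))
  have hνK : ν (unitaryInt (galAdicCompletionMap (L := E) c hw) ((StdForm.antidiagonal 2).over (w.1.adicCompletion E))) ≠ ∞ :=
    (isCompact_unitaryInt_adicCompletion c v w hw ((StdForm.antidiagonal 2).over (w.1.adicCompletion E))).measure_lt_top.ne
  exact orbitalIntegral_coeff_toVector_xiHCoeff_eq_closed_two (unramifiedLocalConjDatum_localConjUniformizer c hc1 v w hw hv) γ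
    (⟨zpowDiagGL (uniformizer_ne_zero (unramifiedLocalConjDatum_localConjUniformizer c hc1 v w hw hv).vϖ) ![(1 : ℤ), -1],
      zpowDiagGL_mem_unitaryGroupOfForm (unramifiedLocalConjDatum_localConjUniformizer c hc1 v w hw hv).σϖ _
        Summit.HodgeConjecture.HodgeConjecture.Cruxes.HLiu418.K2LiuRankOneHeckeCellsTwo.rev_vecOne⟩ :
      ↥(unitaryGroupOfForm (galAdicCompletionMap (L := E) c hw) ((StdForm.antidiagonal 2).over (w.1.adicCompletion E))))
    rfl hA ρ ν hρ hνK hloc hu hfix cty hc0 (Nat.sqrt (Nat.card (Valued.ResidueField (w.1.adicCompletion E)))) hdeg m hm _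
    (satakeGraphPartnerAlgHom_doubleCosetOperator_torusGen_pow c hc1 v w hw hv m)

end Adic

end Summit.HodgeConjecture.HodgeConjecture.R90.S6

end
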